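import Literature.Analysis.FluidPDE.EulerAxisymNoSwirlGlobal
import Literature.Analysis.FluidPDE.BoussinesqSmallScaleFormation
import Mathlib.Analysis.SpecialFunctions.Pow.Deriv
import HarnessLib

/-!
# Rates of vortex stretching for ANTI-PARALLEL (head-on, mirror-class, wall-free) axisymmetric
# Euler flows without swirl on `ℝ³`: Choi–Jeong (AJM 2025) Thm 1.1 and Lim–Jeong (ARMA 2025)
# Thm 1.1 as named facts, with the real-variable skeleton of both printed rate proofs PROVED

Two printed theorems about the SAME class of flows — 3-D axisymmetric incompressible Euler WITHOUT
swirl in the whole space `ℝ³` (no wall), data with compactly supported vorticity bounded by `c·r`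
near the axis (the Ukhovskii–Yudovich / Majda–Bertozzi global class, tree fact
`MajdaBertozzi2002_axisymNoSwirlGlobal`) — typed as named `Prop`s, plus proved bookkeeping:

* K. Choi, I.-J. Jeong, *On vortex stretching for anti-parallel axisymmetric flows*, Amer. J. Math.
  **147** (2025) 1251–1284 = arXiv:2110.09079 (held text `paper:arxiv-2110.09079`, chunks p0003–p0005
  statements, p0009–p0010 §2, p0019 §6). **Theorem 1.1 (Impulse and diameter growth)** [p0003 L41–75]:
  in the ANTI-PARALLEL class (1.5) — `ω^θ(t,r,−z) = −ω^θ(t,r,z)`, `ω^θ ≤ 0` for `z ≥ 0`, "the flow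
  setup for head-on collision of anti-parallel vortex rings" — with `0 < ∬_{[0,∞)²} −z ω₀^θ dr dz < ∞`
  and `0 < ∬_{[0,∞)²} −r² ω₀^θ dr dz < ∞`, the unique global solution has
  `∬ −z ω^θ(t) dr dz` STRICTLY DECREASING in time, `∬ −r² ω^θ(t) dr dz` STRICTLY INCREASING in time,
  and for every `ε > 0`, `∬ −r² ω^θ(t) dr dz ≥ C_ε (1 + t)^{2/15 − ε}` for all `t ≥ 0` (`C_ε > 0`
  depending on `ε` and `ω₀`); in particular `sup {r : x ∈ supp ω(t)} ≥ C_ε (1 + t)^{1/15 − ε}`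
  whenever `ω₀` is compactly supported in `r`. ⟶ `ChoiJeong2025_impulseMonotone`.
* D. Lim, I.-J. Jeong, *On the optimal rate of vortex stretching for axisymmetric Euler flows without
  swirl*, Arch. Ration. Mech. Anal. **249** (2025) = arXiv:2409.19497 (held texts
  `paper:arxiv-2409.19497` p0003 L39 statement, p0010 Prop. 3.1, p0011 L85–112 proof;
  `paper:doi-10-1007-s00205-025-02103-1`). **Theorem 1.1** [p0003 L39]: "Assume that `ω₀^θ` is
  compactly supported and `‖r⁻¹ω₀^θ‖_{L^∞(ℝ³)}` is bounded. Then the corresponding unique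
  global-in-time solution … satisfies, for some constant `A(ω₀^θ) > 0` depending only on `ω₀^θ`,
  `‖ω(t,·)‖_{L^∞(ℝ³)} ≤ A(ω₀^θ)(1 + |t|)^{4/3}` for all `t ∈ ℝ`" — the rate conjectured optimal by
  Childress (ibid. §1.3–1.4). ⟶ `LimJeong2025_vorticityMaxGrowth`.

## The printed proofs and what is PROVED here

Both rate proofs have the same three-step architecture (Choi–Jeong §2.3 "The `t²` bound on the
vorticity maximum", p0010; Lim–Jeong §3.2, p0011 L85–112):
(i) a KINEMATIC bound for the radial velocity at the edge `R(t)` of the vorticity support —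
Feng–Šverák's `‖u‖_∞ ≤ C‖rω‖₁^{1/4}‖r⁻¹ω‖₁^{1/4}‖r⁻¹ω‖_∞^{1/2} ≤ C R^{1/2}‖r⁻¹ω₀‖₁^{1/2}‖r⁻¹ω₀‖_∞^{1/2}`
(CJ Lemma 2.2), resp. Lim–Jeong's Prop. 3.1
`sup_z |u^r(R,z)| ≲ ‖r⁻¹ω‖_∞^{1/3}‖r⁻¹ω‖₁^{2/3} + R^{1/4}‖u‖₂^{1/2}‖r⁻¹ω‖_∞^{1/2}`, all factors
conserved (kinetic energy, `L^p` norms of `ξ = ω^θ/r`, which is transported: `∂ₜξ + u·∇ξ = 0`);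
(ii) the ODE comparison `Ṙ ≤ K (c + R)^θ ⟹ R(t) ≲ (1 + t)^{1/(1−θ)}` with `θ = 1/2` (rate `t²`) resp.
`θ = 1/4` (rate `t^{4/3}`);
(iii) the Cauchy formula `ω^θ(t, Φ_t x)/Φ_t^r(x) = ω₀^θ(x)/r` [CJ (2.6)], whence
`‖ω(t)‖_∞ ≤ ‖r⁻¹ω₀‖_∞ R(t)`.
Step (ii) is PROVED below in full generality as real-variable theorems
(`rpow_le_affine_of_deriv_le_mul_rpow`, `le_rpow_of_deriv_le_mul_rpow`,
`le_mul_one_add_rpow_of_deriv_le_mul_rpow`, and the two printed instances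
`le_mul_one_add_sq_of_deriv_le_mul_sqrt` (`θ = 1/2`, CJ (2.8)) and
`le_mul_one_add_rpow_four_thirds_of_deriv_le` (`θ = 1/4`, LJ (3.12))), from Mathlib's fencing
theorem `image_le_of_deriv_right_le_deriv_boundary` applied to `(c + R)^{1−θ}`. Steps (i) and (iii)
(axisymmetric Biot–Savart estimates; Lagrangian transport of `ω^θ/r`) are the analytic content of
the papers and are NOT re-proved: the two theorems are typed as named facts (net debt +2).

Also PROVED: the anti-parallel sign bookkeeping (`IsAntiParallel.angularVorticity_nonneg_of_nonpos`:
`ω^θ ≥ 0` on the lower half space, from the tree's pseudovector law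
`IsMirrorSymmetricZ.angularVorticity_reflectZ`), non-negativity of both half-space moments in the
class (`IsAntiParallel.halfSpaceAxialMoment_nonneg`, `….halfSpaceRadialImpulse_nonneg`), and the
readings the consumers cite: `LimJeong2025_vorticityMaxGrowth.not_vorticityBlowsUpAt` (no
finite-time vorticity blow-up in the class — the quantitative twin of
`MajdaBertozzi2002_axisymNoSwirlGlobal.exists_global_not_vorticityBlowsUpAt`),
`ChoiJeong2025_impulseMonotone.halfSpaceAxialMoment_lt_initial` /
`….halfSpaceRadialImpulse_gt_initial` (the two EXACT one-signed functionals of a head-on collision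
run) and `….halfSpaceRadialImpulse_unbounded_of_global`.

## Why the cell wants it (ns-blowup D-0081 §A1 zone Z8; pub-fluidc §E "rings, head-on" anchor)

Zone Z8 searches for a wall-free analogue of the Hou–Luo corner collapse in the MIRROR class
(reflection `z ↦ −z`, tree `IsMirrorSymmetricZ` = "class E", head-on collision of mirror-image
structures; ZONE-LIT-Z8.md §2b). In the NO-SWIRL sub-class the Euler-level answer is a THEOREM:
no collapse at all (`MajdaBertozzi2002_axisymNoSwirlGlobal`), and — this file — the stretching is
ALGEBRAIC with printed exponents, `C_ε(1+t)^{2/15−ε} ≤ ∬_{Π₊} −r²ω^θ` (CJ) and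
`‖ω(t)‖_∞ ≤ A(1+t)^{4/3}` (LJ, optimal per Childress), with two EXACTLY MONOTONE functionals
(`halfSpaceAxialMoment` decreasing, `halfSpaceRadialImpulse` increasing) that a no-swirl control
run of a Z8 engine (eng-13 / eng-14) can print as engine-check invariants next to the tree's plane
invariants `IsMirrorSymmetricZ.axial_eq_zero_of_plane` / `….angularVorticity_eq_zero_of_plane`.
So every Z8 KEEP object at the Euler level carries swirl (ZONE-LIT-Z8 §3), and in the swirl-free
mirror class "growth" means `t^{4/3}` at most. The pub-fluidc cell cites CJ Thm 1.1 as its §E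
anchor (LITERATURE.md: "an axisymmetric (unperturbed) rings run is a NULL for that family by
theorem"); `Summits/…/FluidComputer/LazyClock.lean` takes an algebraic sup bound of this kind as a
hypothesis.

## Rendering notes (read before citing)

* Both papers state their theorems for "the unique global-in-time solution" in the Yudovich-type
  class `ω, r⁻¹ω ∈ L^∞_t(L¹ ∩ L^∞)` (CJ §2.3 p0009, citing Ukhovskii–Yudovich, Raymond, Danchin;
  LJ §1.2 and footnote 2: "Uniqueness for (1.1) (but not existence) is guaranteed just with
  `ω ∈ L^∞_{t,x}`, see [Danchin]"). The facts below quantify over EVERY classical Euler solution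
  `(u, p)` on `[0, T) × ℝ³` from the datum whose slices have finite energy (so that `u(t)` is the
  Biot–Savart velocity of its vorticity — the device of `MajdaBertozzi2002_axisymNoSwirlGlobal`), are
  axisymmetric without swirl, and whose vorticity supports stay in a fixed ball on every compact
  `[0, T'] ⊂ [0, T)` (`IsClassicalAxisymNoSwirlEuler`): such a solution lies in the printed
  uniqueness class (continuous vorticity with locally uniformly bounded support is bounded on
  `[0,T'] × ℝ³`), hence coincides on `[0, T)` with the unique global solution, so each printed
  conclusion holds for it on `[0, T)`. This is the reading "modulo the uniqueness theorem the papers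
  themselves invoke [Danchin 2007]", exactly as for the sibling facts
  `MajdaBertozzi2002_axisymNoSwirlGlobal` / `KiselevParkYao2022_annulusSwirlGrowth`.
* The anti-parallel class (CJ (1.5)) is printed on `ω^θ`; here it is `IsAntiParallel u₀` :=
  mirror symmetry of the VELOCITY (`IsMirrorSymmetricZ`, which gives `ω^θ` odd in `z` by the tree's
  `IsMirrorSymmetricZ.angularVorticity_reflectZ`) together with the sign condition `ω^θ ≤ 0` on
  `{z ≥ 0}` — for axisymmetric swirl-free finite-energy fields the velocity-level and
  vorticity-level parities are equivalent (Biot–Savart), and the velocity-level one is what an engine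
  imposes. `angularVorticity` is the tree's `⟪curl u, e_θ⟫` with `e_θ = (−x₁, x₀, 0)/r`, the
  standard orientation used by CJ/LJ (`ω = ω^θ e_θ`, "a single vortex ring with negative axial
  vorticity travels downward", CJ p0004), so the printed sign is kept verbatim.
* LJ print `(1 + |t|)^{4/3}` for all `t ∈ ℝ`; typed forward in time (`t ∈ [0, T)`), the only
  direction the consumers use. CJ's diameter clause `sup{r} ≥ C_ε(1+t)^{1/15−ε}` is typed as "some
  point of the vorticity support has `r > C(1+t)^{1/15−ε}`" (implied by print with `C = C_ε/2`).
* NOT typed (recorded): CJ Cor. 1.2 (growth of `‖ω(t)‖_{L^p}` under the extra hypothesis (1.6) on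
  `r/|ω₀|`), Thm 1.4 (`limsup ‖ω(t)‖_∞/(1+t)^{β₀−ε} = ∞`), **Thm 1.5** [p0005 L1]: "There exists an
  initial datum `ω₀ ∈ C_c^∞(ℝ³)` whose associated Euler solution satisfies
  `limsup_{t→∞} ‖ω(t,·)‖_{C^α(ℝ³)} = +∞` for any `α > 0`" (the wall-free 3-D companion of the
  Kiselev–Šverák / Zlatoš rows of ZONE-LIT-Z8), and **Prop. 6.1** [p0019] (Navier–Stokes, axisymmetric
  no swirl: if the Euler solution from `ω₀` has `limsup_{t→∞} ‖ω(t)‖_{L²} = ∞` then for data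
  `ω₀^ν → ω₀` in `L²`, `liminf_{ν→0⁺} sup_{t≥0} ‖ω^ν(t)‖_{L²} = +∞` — enstrophy INFLATION in the
  globally regular viscous no-swirl class); LJ Prop. 3.1 (the `R^{1/4}` edge estimate) and Thm 1.3
  (dimensions `d ≥ 4`). Printed neighbours (preprints, not typed): Cao–Fan–Qin arXiv:2511.03171
  (radial moment `≥ (1+t)^{3/2}/log^{5/2}` on most late times for patch data), arXiv:2512.13456
  (`P₂(t) ≳ t^{1−}`, upper bounds for radial moments); Childress's `t^{4/3}` scenario (LJ §1.3–1.4);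
  Gustafson–Miller–Tsai (LJ ref. [GMT2023]).

WHAT THIS IS NOT: not Navier–Stokes (except the recorded, untyped Prop. 6.1) and no statement about
flows WITH swirl — a typed record of two printed inviscid no-swirl theorems plus proved real-variable
bookkeeping; nothing here bears on blow-up of Euler or NS with swirl.

## Mathlib / tree search

Tree: `IsMirrorSymmetricZ`, `reflectZ`, `IsMirrorSymmetricZ.angularVorticity_reflectZ`
(`BoussinesqSmallScaleFormation`), `angularVorticity` (`ChenHouBlowup`), `meridianPoint`
(`MeridianReduction`), `IsClassicalEulerOnDomain`, `HasFiniteEnergy`, `IsAxisymmetric`, `HasNoSwirl`,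
`cylRadius`, `VorticityBlowsUpAt`, `curl` (`AxisymmetricEuler`, `VectorCalculus`),
`MajdaBertozzi2002_axisymNoSwirlGlobal`, `curl_axisBound_of_contDiff_two` (`EulerAxisymNoSwirlGlobal`);
nothing on Choi–Jeong / Lim–Jeong / vorticity impulse (`lean search 'ChoiJeong|antiParallel|
vorticityImpulse'` = one docstring mention in `FluidComputer/LazyClock.lean`). Mathlib:
`image_le_of_deriv_right_le_deriv_boundary`, `HasDerivWithinAt.rpow_const`, `Real.rpow_rpow_inv`,
`Real.pow_rpow_inv_natCast`, `MeasureTheory.setIntegral_nonneg`.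

## References

* K. Choi, I.-J. Jeong, Amer. J. Math. 147 (2025) 1251–1284, doi:10.1353/ajm.2025.a971091,
  arXiv:2110.09079: Thm 1.1 (p. 3), (1.5), §2.3 Lemma 2.2 and (2.8) (p. 10), Thm 1.5 (p. 5),
  Prop. 6.1 (p. 19). [`ChoiJeong2025`]
* D. Lim, I.-J. Jeong, Arch. Ration. Mech. Anal. 249 (2025), doi:10.1007/s00205-025-02103-1,
  arXiv:2409.19497: Thm 1.1 (§1.1), Prop. 3.1 (§3.1), proof of Thm 1.1 (§3.2, (3.12)).
  [`LimJeong2025`]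
* R. Danchin, Russian Math. Surveys 62 (2007) 475–496 (uniqueness class). [`Danchin2007`]
* H. Feng, V. Šverák, Arch. Ration. Mech. Anal. 215 (2015) 89–123 (the velocity estimate of step (i)).
* A. J. Majda, A. L. Bertozzi, *Vorticity and Incompressible Flow*, CUP 2002, §4.3 Prop. 4.4.
  [`MajdaBertozziCUP2002`]
-/

noncomputable section

open MeasureTheory Set Function Filter TopologicalSpace WithLp
open _root_.Topology
open scoped ContDiff NNReal ENNReal

namespace Literature.Analysis.FluidPDE

/-! ### Step (ii) of both printed proofs: `R' ≤ K (c + R)^θ`, `0 ≤ θ < 1` ⟹ algebraic growth -/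

/-- **Power-law comparison (Bihari form), the real-variable core of CJ §2.3 and LJ §3.2.** If `f` is
continuous on `[0, T]`, non-negative, right-differentiable on `[0, T)` with `f' ≤ K (c + f)^θ`
(`θ < 1`, `c > 0`, any `K`), then `(c + f(t))^{1−θ} ≤ (c + f(0))^{1−θ} + (1−θ) K t` on `[0, T]`.
Proof: `g = (c+f)^{1−θ}` has right derivative `(1−θ)(c+f)^{−θ} f' ≤ (1−θ)K`; Mathlib's fencing
theorem `image_le_of_deriv_right_le_deriv_boundary`.
[cite: LimJeong2025, §3.2 proof of Theorem 1.1 ((3.11)–(3.12), arXiv:2409.19497 p0011 L85–L105); ChoiJeong2025 §2.3 (2.8)] -/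
theorem rpow_le_affine_of_deriv_le_mul_rpow {f f' : ℝ → ℝ} {T K c θ : ℝ}
    (hθ₁ : θ < 1) (hc : 0 < c)
    (hf : ContinuousOn f (Icc 0 T)) (hf' : ∀ t ∈ Ico 0 T, HasDerivWithinAt f (f' t) (Ici t) t)
    (hpos : ∀ t ∈ Icc 0 T, 0 ≤ f t) (hb : ∀ t ∈ Ico 0 T, f' t ≤ K * (c + f t) ^ θ) :
    ∀ t ∈ Icc 0 T, (c + f t) ^ (1 - θ) ≤ (c + f 0) ^ (1 - θ) + (1 - θ) * K * t := by
  have hcf : ∀ t ∈ Icc 0 T, 0 < c + f t := fun t ht => add_pos_of_pos_of_nonneg hc (hpos t ht)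
  have hg : ContinuousOn (fun t => (c + f t) ^ (1 - θ)) (Icc 0 T) :=
    (continuousOn_const.add hf).rpow_const fun t ht => Or.inl (hcf t ht).ne'
  have hg' : ∀ t ∈ Ico 0 T, HasDerivWithinAt (fun s => (c + f s) ^ (1 - θ))
      (f' t * (1 - θ) * (c + f t) ^ (1 - θ - 1)) (Ici t) t := fun t ht =>
    ((hf' t ht).const_add c).rpow_const (Or.inl (hcf t (Ico_subset_Icc_self ht)).ne')
  have hB : ContinuousOn (fun t => (c + f 0) ^ (1 - θ) + (1 - θ) * K * t) (Icc 0 T) := by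
    fun_prop
  have hB' : ∀ t ∈ Ico 0 T, HasDerivWithinAt (fun s => (c + f 0) ^ (1 - θ) + (1 - θ) * K * s)
      ((1 - θ) * K) (Ici t) t := fun t _ => by
    have h := ((hasDerivWithinAt_id t (Ici t)).const_mul ((1 - θ) * K)).const_add
      ((c + f 0) ^ (1 - θ))
    simpa using h
  have hbound : ∀ t ∈ Ico 0 T, f' t * (1 - θ) * (c + f t) ^ (1 - θ - 1) ≤ (1 - θ) * K := by
    intro t ht
    have hpos' := hcf t (Ico_subset_Icc_self ht)
    have hθpos : 0 < (c + f t) ^ θ := Real.rpow_pos_of_pos hpos' θ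
    have h1 : (c + f t) ^ (1 - θ - 1) = ((c + f t) ^ θ)⁻¹ := by
      rw [show (1 - θ - 1) = -θ by ring, Real.rpow_neg hpos'.le]
    rw [h1]
    have h2 := mul_le_mul_of_nonneg_right
      (mul_le_mul_of_nonneg_right (hb t ht) (sub_nonneg.2 hθ₁.le)) (inv_nonneg.2 hθpos.le)
    calc f' t * (1 - θ) * ((c + f t) ^ θ)⁻¹
        ≤ K * (c + f t) ^ θ * (1 - θ) * ((c + f t) ^ θ)⁻¹ := h2
      _ = (1 - θ) * K := by
        field_simp
  intro t ht
  exact image_le_of_deriv_right_le_deriv_boundary hg hg' (by simp) hB hB' hbound ht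

/-- **Inverted form**: under the hypotheses of `rpow_le_affine_of_deriv_le_mul_rpow`,
`c + f(t) ≤ ((c + f(0))^{1−θ} + (1−θ) K t)^{1/(1−θ)}` on `[0, T]` — LJ (3.12) with `θ = 1/4`
(`R(t) ≲ (1+t)^{4/3}`), CJ (2.8) with `θ = 1/2` (`R(t) ≤ C(1+t)²`).
[cite: LimJeong2025, §3.2 (3.12) (arXiv:2409.19497 p0011 L100–L101); ChoiJeong2025 §2.3 (2.8) (arXiv:2110.09079 p0010)] -/
theorem le_rpow_of_deriv_le_mul_rpow {f f' : ℝ → ℝ} {T K c θ : ℝ}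
    (hθ₁ : θ < 1) (hc : 0 < c)
    (hf : ContinuousOn f (Icc 0 T)) (hf' : ∀ t ∈ Ico 0 T, HasDerivWithinAt f (f' t) (Ici t) t)
    (hpos : ∀ t ∈ Icc 0 T, 0 ≤ f t) (hb : ∀ t ∈ Ico 0 T, f' t ≤ K * (c + f t) ^ θ) :
    ∀ t ∈ Icc 0 T,
      c + f t ≤ ((c + f 0) ^ (1 - θ) + (1 - θ) * K * t) ^ (1 / (1 - θ)) := by
  intro t ht
  have h := rpow_le_affine_of_deriv_le_mul_rpow hθ₁ hc hf hf' hpos hb t ht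
  have hpos' : 0 < c + f t := add_pos_of_pos_of_nonneg hc (hpos t ht)
  have h1θ : 0 < 1 - θ := sub_pos.2 hθ₁
  calc c + f t = ((c + f t) ^ (1 - θ)) ^ (1 / (1 - θ)) := by
        rw [one_div, Real.rpow_rpow_inv hpos'.le h1θ.ne']
    _ ≤ ((c + f 0) ^ (1 - θ) + (1 - θ) * K * t) ^ (1 / (1 - θ)) :=
        Real.rpow_le_rpow (Real.rpow_nonneg hpos'.le _) h (one_div_nonneg.2 h1θ.le)

/-- **Algebraic-rate law** (the shape in which both papers state their rates): under the hypotheses of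
`rpow_le_affine_of_deriv_le_mul_rpow`, `f(t) ≤ A (1 + t)^{1/(1−θ)}` on `[0, T]` with the explicit
constant `A = ((c + f(0))^{1−θ} + (1−θ)K)^{1/(1−θ)}` (independent of `T`).
[cite: LimJeong2025, Theorem 1.1 via §3.2 (3.12) (arXiv:2409.19497 p0011 L85–L112); ChoiJeong2025 §2.3 (2.8)] -/
theorem le_mul_one_add_rpow_of_deriv_le_mul_rpow {f f' : ℝ → ℝ} {T K c θ : ℝ}
    (hθ₁ : θ < 1) (hc : 0 < c) (hK : 0 ≤ K)
    (hf : ContinuousOn f (Icc 0 T)) (hf' : ∀ t ∈ Ico 0 T, HasDerivWithinAt f (f' t) (Ici t) t)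
    (hpos : ∀ t ∈ Icc 0 T, 0 ≤ f t) (hb : ∀ t ∈ Ico 0 T, f' t ≤ K * (c + f t) ^ θ) :
    ∀ t ∈ Icc 0 T,
      f t ≤ ((c + f 0) ^ (1 - θ) + (1 - θ) * K) ^ (1 / (1 - θ)) * (1 + t) ^ (1 / (1 - θ)) := by
  intro t ht
  have h := le_rpow_of_deriv_le_mul_rpow hθ₁ hc hf hf' hpos hb t ht
  have h1θ : 0 < 1 - θ := sub_pos.2 hθ₁
  set a : ℝ := (c + f 0) ^ (1 - θ) with ha_def
  set b : ℝ := (1 - θ) * K with hb_def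
  have ha : 0 ≤ a := Real.rpow_nonneg (add_pos_of_pos_of_nonneg hc (hpos 0 (left_mem_Icc.2
    (ht.1.trans ht.2)))).le _
  have hb0 : 0 ≤ b := mul_nonneg h1θ.le hK
  have ht0 : 0 ≤ t := ht.1
  have hab : a + b * t ≤ (a + b) * (1 + t) := by nlinarith
  have hp : 0 ≤ 1 / (1 - θ) := one_div_nonneg.2 h1θ.le
  calc f t ≤ c + f t := le_add_of_nonneg_left hc.le
    _ ≤ (a + b * t) ^ (1 / (1 - θ)) := h
    _ ≤ ((a + b) * (1 + t)) ^ (1 / (1 - θ)) :=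
        Real.rpow_le_rpow (add_nonneg ha (mul_nonneg hb0 ht0)) hab hp
    _ = (a + b) ^ (1 / (1 - θ)) * (1 + t) ^ (1 / (1 - θ)) :=
        Real.mul_rpow (add_nonneg ha hb0) (by linarith)

/-- **The `t²` law** (Choi–Jeong §2.3, (2.8): `Ṙ ≤ C R^{1/2} ‖r⁻¹ω₀‖₁^{1/2}‖r⁻¹ω₀‖_∞^{1/2}`
"Integrating in time gives `R(t) ≤ C(1+t)²`"): `f' ≤ K (c + f)^{1/2}` on `[0, T)` implies
`f(t) ≤ ((c + f(0))^{1/2} + K/2)² (1 + t)²` on `[0, T]`.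
[cite: ChoiJeong2025, §2.3 "The t² bound on the vorticity maximum", (2.8) (arXiv:2110.09079 p0010)] -/
theorem le_mul_one_add_sq_of_deriv_le_mul_sqrt {f f' : ℝ → ℝ} {T K c : ℝ}
    (hc : 0 < c) (hK : 0 ≤ K)
    (hf : ContinuousOn f (Icc 0 T)) (hf' : ∀ t ∈ Ico 0 T, HasDerivWithinAt f (f' t) (Ici t) t)
    (hpos : ∀ t ∈ Icc 0 T, 0 ≤ f t)
    (hb : ∀ t ∈ Ico 0 T, f' t ≤ K * (c + f t) ^ (1 / 2 : ℝ)) :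
    ∀ t ∈ Icc 0 T, f t ≤ ((c + f 0) ^ (1 / 2 : ℝ) + K / 2) ^ 2 * (1 + t) ^ 2 := by
  intro t ht
  have h := le_mul_one_add_rpow_of_deriv_le_mul_rpow (θ := 1 / 2) (by norm_num) hc hK hf hf'
    hpos hb t ht
  have h1 : (1 : ℝ) - 1 / 2 = 1 / 2 := by norm_num
  have h2 : (1 : ℝ) / (1 / 2) = 2 := by norm_num
  rw [h1, h2] at h
  have h3 : ((1 : ℝ) / 2) * K = K / 2 := by ring
  rw [h3] at h
  rwa [show ((2 : ℝ)) = ((2 : ℕ) : ℝ) by norm_num, Real.rpow_natCast, Real.rpow_natCast] at h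

/-- **The `t^{4/3}` law** (Lim–Jeong §3.2: `|Ṙ| ≤ C(c₁(ω₀) + c₂(ω₀) R^{1/4})` "This gives us the
bound `R(t) ≲_{ω₀} (1+t)^{4/3}`", (3.12)): `f' ≤ K (c + f)^{1/4}` on `[0, T)` implies
`f(t) ≤ ((c + f(0))^{3/4} + (3/4)K)^{4/3} (1 + t)^{4/3}` on `[0, T]`.
[cite: LimJeong2025, §3.2 proof of Theorem 1.1, (3.12) (arXiv:2409.19497 p0011 L85–L101)] -/
theorem le_mul_one_add_rpow_four_thirds_of_deriv_le {f f' : ℝ → ℝ} {T K c : ℝ}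
    (hc : 0 < c) (hK : 0 ≤ K)
    (hf : ContinuousOn f (Icc 0 T)) (hf' : ∀ t ∈ Ico 0 T, HasDerivWithinAt f (f' t) (Ici t) t)
    (hpos : ∀ t ∈ Icc 0 T, 0 ≤ f t)
    (hb : ∀ t ∈ Ico 0 T, f' t ≤ K * (c + f t) ^ (1 / 4 : ℝ)) :
    ∀ t ∈ Icc 0 T,
      f t ≤ ((c + f 0) ^ (3 / 4 : ℝ) + 3 / 4 * K) ^ (4 / 3 : ℝ) * (1 + t) ^ (4 / 3 : ℝ) := by
  intro t ht
  have h := le_mul_one_add_rpow_of_deriv_le_mul_rpow (θ := 1 / 4) (by norm_num) hc hK hf hf'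
    hpos hb t ht
  have h1 : (1 : ℝ) - 1 / 4 = 3 / 4 := by norm_num
  have h2 : (1 : ℝ) / (3 / 4) = 4 / 3 := by norm_num
  rw [h1, h2] at h
  exact h

/-! ### The anti-parallel (head-on collision) class and its half-space moments -/

/-- The closed upper quadrant `Π₊ = [0, ∞) × [0, ∞)` of the meridian half-plane
(`r ≥ 0`, `z ≥ 0`), the integration domain `[0,∞)²` of Choi–Jeong's Theorem 1.1.
[cite: ChoiJeong2025, Theorem 1.1 (arXiv:2110.09079 p0003 L41–L60)] -/
def upperMeridianQuadrant : Set (ℝ × ℝ) :=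
  Ici 0 ×ˢ Ici 0

/-- `Π₊` is measurable. [cite: ChoiJeong2025, Theorem 1.1 (arXiv:2110.09079 p0003 L41–L60)] -/
theorem measurableSet_upperMeridianQuadrant : MeasurableSet upperMeridianQuadrant :=
  measurableSet_Ici.prod measurableSet_Ici

/-- Membership in `Π₊`: `q ∈ Π₊ ↔ 0 ≤ q.1 ∧ 0 ≤ q.2`. [cite: ChoiJeong2025, Theorem 1.1 (arXiv:2110.09079 p0003 L41–L60)] -/
theorem mem_upperMeridianQuadrant {q : ℝ × ℝ} :
    q ∈ upperMeridianQuadrant ↔ 0 ≤ q.1 ∧ 0 ≤ q.2 := by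
  simp only [upperMeridianQuadrant, mem_prod, mem_Ici]

/-- The angular vorticity in meridian coordinates, `ω^θ(r, z) := ω^θ(r, 0, z)`
(`angularVorticity v ∘ meridianPoint`; for an axisymmetric field this is the printed scalar
`ω^θ(r,z)` with `ω = ω^θ e_θ`, CJ (1.3)). [cite: ChoiJeong2025, §1.1 (1.3)–(1.5) (arXiv:2110.09079 p0003 L17–L38)] -/
def meridianAngularVorticity (v : EuclideanSpace ℝ (Fin 3) → EuclideanSpace ℝ (Fin 3))
    (q : ℝ × ℝ) : ℝ :=
  angularVorticity v (meridianPoint q)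

/-- Unfolding `meridianAngularVorticity`. [cite: ChoiJeong2025, §1.1 (1.3) (arXiv:2110.09079 p0003 L17–L30)] -/
theorem meridianAngularVorticity_apply (v : EuclideanSpace ℝ (Fin 3) → EuclideanSpace ℝ (Fin 3))
    (q : ℝ × ℝ) : meridianAngularVorticity v q = angularVorticity v (meridianPoint q) :=
  rfl

/-- **The height moment of the upper-half vorticity**, `P_z[v] := ∬_{[0,∞)²} (−z) ω^θ(r,z) dr dz`
(Choi–Jeong Thm 1.1, first functional: "strictly decreasing in time"). Bochner integral over `Π₊`
for the product Lebesgue measure `dr dz` (junk value `0` if not integrable).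
[cite: ChoiJeong2025, Theorem 1.1 (arXiv:2110.09079 p0003 L41–L60)] -/
def halfSpaceAxialMoment (v : EuclideanSpace ℝ (Fin 3) → EuclideanSpace ℝ (Fin 3)) : ℝ :=
  ∫ q in upperMeridianQuadrant, -(q.2 * meridianAngularVorticity v q)

/-- **The radial impulse of the upper-half vorticity**, `P_r[v] := ∬_{[0,∞)²} (−r²) ω^θ(r,z) dr dz`
(Choi–Jeong Thm 1.1, second functional — "the vorticity impulse on the upper half-space":
"strictly increasing in time" and `≥ C_ε(1+t)^{2/15−ε}`).
[cite: ChoiJeong2025, Theorem 1.1 (arXiv:2110.09079 p0003 L41–L70)] -/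
def halfSpaceRadialImpulse (v : EuclideanSpace ℝ (Fin 3) → EuclideanSpace ℝ (Fin 3)) : ℝ :=
  ∫ q in upperMeridianQuadrant, -(q.1 ^ 2 * meridianAngularVorticity v q)

/-- **The anti-parallel class** (Choi–Jeong (1.5): "vorticities which are odd in `z` (“anti-parallel”)
and non-positive on the upper half-space `ℝ³₊ = {z > 0}`", the head-on collision of anti-parallel
vortex rings), rendered at the velocity level: `v` is mirror-symmetric in `z` (`v(Rx) = R v(x)`,
tree `IsMirrorSymmetricZ`, which makes `ω^θ` odd in `z`) and `ω^θ ≤ 0` on `{z ≥ 0}`.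
[cite: ChoiJeong2025, §1.1 (1.5) (arXiv:2110.09079 p0003 L31–L38)] -/
def IsAntiParallel (v : EuclideanSpace ℝ (Fin 3) → EuclideanSpace ℝ (Fin 3)) : Prop :=
  IsMirrorSymmetricZ v ∧ ∀ x : EuclideanSpace ℝ (Fin 3), 0 ≤ x 2 → angularVorticity v x ≤ 0

/-- Anti-parallel fields are mirror-symmetric. [cite: ChoiJeong2025, §1.1 (1.5) (arXiv:2110.09079 p0003 L31–L38)] -/
theorem IsAntiParallel.isMirrorSymmetricZ {v : EuclideanSpace ℝ (Fin 3) → EuclideanSpace ℝ (Fin 3)}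
    (h : IsAntiParallel v) : IsMirrorSymmetricZ v :=
  h.1

/-- The printed sign: `ω^θ ≤ 0` on the closed upper half-space `{z ≥ 0}`.
[cite: ChoiJeong2025, §1.1 (1.5) (arXiv:2110.09079 p0003 L31–L38)] -/
theorem IsAntiParallel.angularVorticity_nonpos {v : EuclideanSpace ℝ (Fin 3) → EuclideanSpace ℝ (Fin 3)}
    (h : IsAntiParallel v) {x : EuclideanSpace ℝ (Fin 3)} (hx : 0 ≤ x 2) :
    angularVorticity v x ≤ 0 :=
  h.2 x hx

/-- By oddness, `ω^θ ≥ 0` on the lower half-space `{z ≤ 0}` (at points of differentiability; the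
tree's pseudovector law `IsMirrorSymmetricZ.angularVorticity_reflectZ`).
[cite: ChoiJeong2025, §1.1 (1.5) (arXiv:2110.09079 p0003 L31–L38)] -/
theorem IsAntiParallel.angularVorticity_nonneg_of_nonpos
    {v : EuclideanSpace ℝ (Fin 3) → EuclideanSpace ℝ (Fin 3)} (h : IsAntiParallel v)
    {x : EuclideanSpace ℝ (Fin 3)} (hd : DifferentiableAt ℝ v x) (hx : x 2 ≤ 0) :
    0 ≤ angularVorticity v x := by
  have hR : 0 ≤ reflectZ x 2 := by rw [reflectZ_apply_two]; linarith
  have h1 := h.2 (reflectZ x) hR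
  rw [h.1.angularVorticity_reflectZ hd] at h1
  linarith

/-- On the mirror plane `{z = 0}` the angular vorticity of a differentiable anti-parallel field
vanishes. [cite: ChoiJeong2025, §1.1 (1.5) (arXiv:2110.09079 p0003 L31–L38)] -/
theorem IsAntiParallel.angularVorticity_eq_zero_of_plane
    {v : EuclideanSpace ℝ (Fin 3) → EuclideanSpace ℝ (Fin 3)} (h : IsAntiParallel v)
    {x : EuclideanSpace ℝ (Fin 3)} (hd : DifferentiableAt ℝ v x) (hx : x 2 = 0) :
    angularVorticity v x = 0 :=
  h.1.angularVorticity_eq_zero_of_plane hd hx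

/-- Non-vacuity: the fluid at rest is anti-parallel. [cite: ChoiJeong2025, §1.1 (1.5) (arXiv:2110.09079 p0003 L31–L38)] -/
theorem isAntiParallel_zero :
    IsAntiParallel (0 : EuclideanSpace ℝ (Fin 3) → EuclideanSpace ℝ (Fin 3)) :=
  ⟨isMirrorSymmetricZ_zero, fun x _ => by simp⟩

/-- In the anti-parallel class the integrand `(−z) ω^θ(r, z)` of the height moment is non-negative on
`Π₊`, so `P_z[v] ≥ 0` (whether or not it is integrable).
[cite: ChoiJeong2025, Theorem 1.1 (arXiv:2110.09079 p0003 L41–L60)] -/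
theorem IsAntiParallel.halfSpaceAxialMoment_nonneg
    {v : EuclideanSpace ℝ (Fin 3) → EuclideanSpace ℝ (Fin 3)} (h : IsAntiParallel v) :
    0 ≤ halfSpaceAxialMoment v := by
  refine setIntegral_nonneg measurableSet_upperMeridianQuadrant fun q hq => ?_
  have hq' := mem_upperMeridianQuadrant.1 hq
  have hω : meridianAngularVorticity v q ≤ 0 :=
    h.angularVorticity_nonpos (x := meridianPoint q) (by simpa using hq'.2)
  nlinarith [hq'.2]

/-- In the anti-parallel class the integrand `(−r²) ω^θ(r, z)` of the radial impulse is non-negative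
on `Π₊`, so `P_r[v] ≥ 0`. [cite: ChoiJeong2025, Theorem 1.1 (arXiv:2110.09079 p0003 L41–L70)] -/
theorem IsAntiParallel.halfSpaceRadialImpulse_nonneg
    {v : EuclideanSpace ℝ (Fin 3) → EuclideanSpace ℝ (Fin 3)} (h : IsAntiParallel v) :
    0 ≤ halfSpaceRadialImpulse v := by
  refine setIntegral_nonneg measurableSet_upperMeridianQuadrant fun q hq => ?_
  have hq' := mem_upperMeridianQuadrant.1 hq
  have hω : meridianAngularVorticity v q ≤ 0 :=
    h.angularVorticity_nonpos (x := meridianPoint q) (by simpa using hq'.2)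
  nlinarith [sq_nonneg q.1]

/-! ### The solution class both theorems speak about -/

/-- **A classical axisymmetric swirl-free Euler flow on `[0, T) × ℝ³` issued from `u₀`** in the
uniqueness class of the printed theorems (module docstring, Rendering notes): a classical solution
`(u, p)` of the unforced incompressible Euler equations on the whole space (`IsClassicalEulerOnDomain`
with `Ω = ℝ³`, no boundary, `f = 0`) on the time interval `[0, T)` with `u(0) = u₀`, whose slices
have finite energy (so `u(t)` is the Biot–Savart velocity of its vorticity), are axisymmetric
without swirl, and whose vorticity supports stay in a fixed ball on every compact `[0, T'] ⊂ [0,T)`.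
(CJ §2.3 / LJ §1.2: the unique global solution for data with `ω₀, r⁻¹ω₀ ∈ L¹ ∩ L^∞`; uniqueness
"just with `ω ∈ L^∞_{t,x}`" [Danchin 2007].)
[cite: LimJeong2025, §1.2 with footnote 2 (arXiv:2409.19497 p0004); ChoiJeong2025 §2.3 (arXiv:2110.09079 p0009 L120–L135)] -/
structure IsClassicalAxisymNoSwirlEuler (T : ℝ)
    (u₀ : EuclideanSpace ℝ (Fin 3) → EuclideanSpace ℝ (Fin 3))
    (u : ℝ → EuclideanSpace ℝ (Fin 3) → EuclideanSpace ℝ (Fin 3))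
    (p : ℝ → EuclideanSpace ℝ (Fin 3) → ℝ) : Prop where
  /-- `(u, p)` is a classical solution of unforced Euler on `[0, T) × ℝ³`. -/
  euler : IsClassicalEulerOnDomain (Ico 0 T) (⊤ : Opens (EuclideanSpace ℝ (Fin 3))) 0 0 u p
  /-- The datum. -/
  initial : u 0 = u₀
  /-- Every slice has finite kinetic energy (`u(t) = K[ω(t)]`). -/
  finiteEnergy : ∀ t ∈ Ico 0 T, HasFiniteEnergy (u t)
  /-- Every slice is axisymmetric. -/
  axisym : ∀ t ∈ Ico 0 T, IsAxisymmetric (u t)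
  /-- Every slice is swirl free. -/
  noSwirl : ∀ t ∈ Ico 0 T, HasNoSwirl (u t)
  /-- On every compact `[0, T']`, `T' < T`, the vorticity supports lie in one ball. -/
  vorticitySupport : ∀ T' < T, ∃ ρ : ℝ, ∀ t ∈ Icc 0 T', ∀ x, curl (u t) x ≠ 0 → ‖x‖ ≤ ρ

/-! ### The named facts -/

/-- **Choi–Jeong 2025, Theorem 1.1 (Impulse and diameter growth).** Printed: "Together with (1.4)
[`ω₀, r⁻¹ω₀ ∈ L¹ ∩ L^∞(ℝ³)`] and (1.5) [`ω^θ` odd in `z`, `ω^θ ≤ 0` for `z ≥ 0`], assume that the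
initial vorticity satisfies `0 < ∬_{[0,∞)²} −z ω₀^θ dr dz < +∞` and
`0 < ∬_{[0,∞)²} −r²ω₀^θ dr dz < +∞`. Then, the unique global solution `ω(t,·)` … satisfies that
`∬_{[0,∞)²} −z ω^θ(t,r,z) dr dz` is strictly decreasing in time, `∬_{[0,∞)²} −r²ω^θ(t,r,z) dr dz` is
strictly increasing in time, and for any `ε > 0`, `∬ −r²ω^θ(t) dr dz ≥ C_ε(1+t)^{2/15−ε}` for all
`t ≥ 0`, where `C_ε > 0` is a constant depending on `ε` and `ω₀`. In particular …
`sup{√(x₁²+x₂²) : x ∈ supp ω(t,·)} ≥ C_ε(1+t)^{1/15−ε}` for all `t ≥ 0` holds whenever `ω₀` is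
compactly supported in `r`." **Rendering** (module docstring): for every datum `u₀` on `ℝ³` with
finite energy, compactly supported vorticity obeying the axis bound `‖ω₀(x)‖ ≤ c·r(x)`, axisymmetric
and swirl free, ANTI-PARALLEL (`IsAntiParallel`), with both half-space moments positive: (a) along
every classical solution from `u₀` in the class `IsClassicalAxisymNoSwirlEuler T u₀ u p` the height
moment `t ↦ P_z[u(t)]` is strictly decreasing and the radial impulse `t ↦ P_r[u(t)]` strictly
increasing on `[0, T)`; (b) for every `ε > 0` there is `C > 0` (depending on `ε`, `u₀` only) with
`C(1+t)^{2/15−ε} ≤ P_r[u(t)]` and a point of the vorticity support with `r > C(1+t)^{1/15−ε}`, for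
every such solution and every `t ∈ [0, T)`.
[cite: ChoiJeong2025, Theorem 1.1 (Amer. J. Math. 147 (2025) 1251; arXiv:2110.09079 p0003 L41–L75)] -/
def ChoiJeong2025_impulseMonotone : Prop :=
  ∀ (u₀ : EuclideanSpace ℝ (Fin 3) → EuclideanSpace ℝ (Fin 3)),
    HasFiniteEnergy u₀ → HasCompactSupport (curl u₀) →
    (∃ c : ℝ, ∀ x, ‖curl u₀ x‖ ≤ c * cylRadius x) →
    IsAxisymmetric u₀ → HasNoSwirl u₀ → IsAntiParallel u₀ →
    0 < halfSpaceAxialMoment u₀ → 0 < halfSpaceRadialImpulse u₀ →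
    (∀ (T : ℝ) (u : ℝ → EuclideanSpace ℝ (Fin 3) → EuclideanSpace ℝ (Fin 3))
        (p : ℝ → EuclideanSpace ℝ (Fin 3) → ℝ), IsClassicalAxisymNoSwirlEuler T u₀ u p →
        StrictAntiOn (fun t => halfSpaceAxialMoment (u t)) (Ico 0 T) ∧
        StrictMonoOn (fun t => halfSpaceRadialImpulse (u t)) (Ico 0 T)) ∧
    (∀ ε : ℝ, 0 < ε → ∃ C : ℝ, 0 < C ∧
      ∀ (T : ℝ) (u : ℝ → EuclideanSpace ℝ (Fin 3) → EuclideanSpace ℝ (Fin 3))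
        (p : ℝ → EuclideanSpace ℝ (Fin 3) → ℝ), IsClassicalAxisymNoSwirlEuler T u₀ u p →
        ∀ t ∈ Ico 0 T,
          C * (1 + t) ^ (2 / 15 - ε) ≤ halfSpaceRadialImpulse (u t) ∧
          ∃ x, curl (u t) x ≠ 0 ∧ C * (1 + t) ^ (1 / 15 - ε) < cylRadius x)

/-- **Lim–Jeong 2025, Theorem 1.1 (the optimal `t^{4/3}` rate of vortex stretching).** Printed:
"Assume that `ω₀^θ` is compactly supported and `‖r⁻¹ω₀^θ‖_{L^∞(ℝ³)}` is bounded. Then the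
corresponding unique global-in-time solution `ω(t,·)` of (1.1) belonging to `L^∞_loc(ℝ; L^∞(ℝ³))`
with the initial data `ω₀ = ω₀^θ e_θ` satisfies, for some constant `A(ω₀^θ) > 0` depending only on
`ω₀^θ`, `‖ω(t,·)‖_{L^∞(ℝ³)} ≤ A(ω₀^θ)(1 + |t|)^{4/3}` for all `t ∈ ℝ`." (Remark 1.1: `A` depends only
on `‖ω₀^θ‖_∞, ‖r⁻¹ω₀^θ‖_∞, ‖r⁻¹ω₀^θ‖₁, ‖u₀‖_{L²}`; any smooth compactly supported vorticity
qualifies.) **Rendering** (module docstring; forward time): for every datum `u₀` on `ℝ³` with finite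
energy, compactly supported vorticity with the axis bound `‖ω₀(x)‖ ≤ c·r(x)` (`= r⁻¹ω₀^θ ∈ L^∞`),
axisymmetric and swirl free, there is `A > 0` such that every classical solution from `u₀` in the
class `IsClassicalAxisymNoSwirlEuler T u₀ u p` obeys `‖curl u(t, x)‖ ≤ A (1 + t)^{4/3}` for all
`t ∈ [0, T)` and all `x`.
[cite: LimJeong2025, Theorem 1.1 with Remark 1.1 (ARMA 249 (2025); arXiv:2409.19497 p0003 L39–L47)] -/
def LimJeong2025_vorticityMaxGrowth : Prop :=
  ∀ (u₀ : EuclideanSpace ℝ (Fin 3) → EuclideanSpace ℝ (Fin 3)),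
    HasFiniteEnergy u₀ → HasCompactSupport (curl u₀) →
    (∃ c : ℝ, ∀ x, ‖curl u₀ x‖ ≤ c * cylRadius x) →
    IsAxisymmetric u₀ → HasNoSwirl u₀ →
    ∃ A : ℝ, 0 < A ∧
      ∀ (T : ℝ) (u : ℝ → EuclideanSpace ℝ (Fin 3) → EuclideanSpace ℝ (Fin 3))
        (p : ℝ → EuclideanSpace ℝ (Fin 3) → ℝ), IsClassicalAxisymNoSwirlEuler T u₀ u p →
        ∀ t ∈ Ico 0 T, ∀ x, ‖curl (u t) x‖ ≤ A * (1 + t) ^ (4 / 3 : ℝ)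

/-! ### Readings (proved): what the facts give at once -/

/-- **Reading of Lim–Jeong Thm 1.1: no finite-time vorticity blow-up in the class.** A classical
axisymmetric swirl-free solution on `[0, T)`, `T > 0`, from a datum as in the fact cannot have
`VorticityBlowsUpAt u T` (`limsup_{t↑T} ‖ω(t)‖_∞ = ∞`): `‖ω(t,x)‖ ≤ A(1+T)^{4/3}` near `T`.
(The quantitative twin of `MajdaBertozzi2002_axisymNoSwirlGlobal.exists_global_not_vorticityBlowsUpAt`;
a Z6/Z8 engine-check sentence: a no-swirl collapse is an engine bug.)
[cite: LimJeong2025, Theorem 1.1 (arXiv:2409.19497 p0003 L39–L47)] -/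
theorem LimJeong2025_vorticityMaxGrowth.not_vorticityBlowsUpAt (h : LimJeong2025_vorticityMaxGrowth)
    {u₀ : EuclideanSpace ℝ (Fin 3) → EuclideanSpace ℝ (Fin 3)} (he : HasFiniteEnergy u₀)
    (hs : HasCompactSupport (curl u₀)) (hax : ∃ c : ℝ, ∀ x, ‖curl u₀ x‖ ≤ c * cylRadius x)
    (ha : IsAxisymmetric u₀) (hn : HasNoSwirl u₀)
    {T : ℝ} {u : ℝ → EuclideanSpace ℝ (Fin 3) → EuclideanSpace ℝ (Fin 3)}
    {p : ℝ → EuclideanSpace ℝ (Fin 3) → ℝ} (hsol : IsClassicalAxisymNoSwirlEuler T u₀ u p)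
    (hT : 0 < T) : ¬ VorticityBlowsUpAt u T := by
  intro hblow
  obtain ⟨A, hA, hmain⟩ := h u₀ he hs hax ha hn
  have hfreq := hblow (A * (1 + T) ^ (4 / 3 : ℝ))
  have hev : ∀ᶠ t in 𝓝[<] T, t ∈ Ico (0 : ℝ) T := by
    filter_upwards [Ioo_mem_nhdsLT hT] with t ht using ⟨ht.1.le, ht.2⟩
  obtain ⟨t, ⟨x, hx⟩, ht⟩ := (hfreq.and_eventually hev).exists
  have hb := hmain T u p hsol t ht x
  have hmono : A * (1 + t) ^ (4 / 3 : ℝ) ≤ A * (1 + T) ^ (4 / 3 : ℝ) := by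
    have h1 : (0 : ℝ) ≤ 1 + t := by linarith [ht.1]
    have h2 : 1 + t ≤ 1 + T := by linarith [ht.2]
    exact mul_le_mul_of_nonneg_left (Real.rpow_le_rpow h1 h2 (by norm_num)) hA.le
  linarith

/-- **Reading of Choi–Jeong Thm 1.1 (a): the height moment never returns to its initial value** —
`P_z[u(t)] < P_z[u₀]` for `0 < t < T` along every solution in the class (an exact one-signed
engine-check functional for a head-on collision run).
[cite: ChoiJeong2025, Theorem 1.1 (arXiv:2110.09079 p0003 L41–L60)] -/
theorem ChoiJeong2025_impulseMonotone.halfSpaceAxialMoment_lt_initial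
    (h : ChoiJeong2025_impulseMonotone)
    {u₀ : EuclideanSpace ℝ (Fin 3) → EuclideanSpace ℝ (Fin 3)} (he : HasFiniteEnergy u₀)
    (hs : HasCompactSupport (curl u₀)) (hax : ∃ c : ℝ, ∀ x, ‖curl u₀ x‖ ≤ c * cylRadius x)
    (ha : IsAxisymmetric u₀) (hn : HasNoSwirl u₀) (hap : IsAntiParallel u₀)
    (hPz : 0 < halfSpaceAxialMoment u₀) (hPr : 0 < halfSpaceRadialImpulse u₀)
    {T : ℝ} {u : ℝ → EuclideanSpace ℝ (Fin 3) → EuclideanSpace ℝ (Fin 3)}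
    {p : ℝ → EuclideanSpace ℝ (Fin 3) → ℝ} (hsol : IsClassicalAxisymNoSwirlEuler T u₀ u p)
    {t : ℝ} (ht : t ∈ Ioo 0 T) :
    halfSpaceAxialMoment (u t) < halfSpaceAxialMoment u₀ := by
  obtain ⟨hmono, -⟩ := h u₀ he hs hax ha hn hap hPz hPr
  have h0 : (0 : ℝ) ∈ Ico 0 T := ⟨le_rfl, ht.1.trans ht.2⟩
  have h1 : halfSpaceAxialMoment (u t) < halfSpaceAxialMoment (u 0) :=
    (hmono T u p hsol).1 h0 ⟨ht.1.le, ht.2⟩ ht.1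
  rwa [hsol.initial] at h1

/-- **Reading of Choi–Jeong Thm 1.1 (a): the radial impulse exceeds its initial value** —
`P_r[u₀] < P_r[u(t)]` for `0 < t < T` along every solution in the class.
[cite: ChoiJeong2025, Theorem 1.1 (arXiv:2110.09079 p0003 L41–L70)] -/
theorem ChoiJeong2025_impulseMonotone.halfSpaceRadialImpulse_gt_initial
    (h : ChoiJeong2025_impulseMonotone)
    {u₀ : EuclideanSpace ℝ (Fin 3) → EuclideanSpace ℝ (Fin 3)} (he : HasFiniteEnergy u₀)
    (hs : HasCompactSupport (curl u₀)) (hax : ∃ c : ℝ, ∀ x, ‖curl u₀ x‖ ≤ c * cylRadius x)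
    (ha : IsAxisymmetric u₀) (hn : HasNoSwirl u₀) (hap : IsAntiParallel u₀)
    (hPz : 0 < halfSpaceAxialMoment u₀) (hPr : 0 < halfSpaceRadialImpulse u₀)
    {T : ℝ} {u : ℝ → EuclideanSpace ℝ (Fin 3) → EuclideanSpace ℝ (Fin 3)}
    {p : ℝ → EuclideanSpace ℝ (Fin 3) → ℝ} (hsol : IsClassicalAxisymNoSwirlEuler T u₀ u p)
    {t : ℝ} (ht : t ∈ Ioo 0 T) :
    halfSpaceRadialImpulse u₀ < halfSpaceRadialImpulse (u t) := by
  obtain ⟨hmono, -⟩ := h u₀ he hs hax ha hn hap hPz hPr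
  have h0 : (0 : ℝ) ∈ Ico 0 T := ⟨le_rfl, ht.1.trans ht.2⟩
  have h1 : halfSpaceRadialImpulse (u 0) < halfSpaceRadialImpulse (u t) :=
    (hmono T u p hsol).2 h0 ⟨ht.1.le, ht.2⟩ ht.1
  rwa [hsol.initial] at h1

/-- **Reading of Choi–Jeong Thm 1.1 (b): along a GLOBAL solution the radial impulse is unbounded** —
for every `B` some time `t ≥ 0` has `P_r[u(t)] > B` (take `ε = 1/15` in the floor
`C_ε(1+t)^{2/15−ε}`). [cite: ChoiJeong2025, Theorem 1.1 (arXiv:2110.09079 p0003 L41–L70)] -/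
theorem ChoiJeong2025_impulseMonotone.halfSpaceRadialImpulse_unbounded_of_global
    (h : ChoiJeong2025_impulseMonotone)
    {u₀ : EuclideanSpace ℝ (Fin 3) → EuclideanSpace ℝ (Fin 3)} (he : HasFiniteEnergy u₀)
    (hs : HasCompactSupport (curl u₀)) (hax : ∃ c : ℝ, ∀ x, ‖curl u₀ x‖ ≤ c * cylRadius x)
    (ha : IsAxisymmetric u₀) (hn : HasNoSwirl u₀) (hap : IsAntiParallel u₀)
    (hPz : 0 < halfSpaceAxialMoment u₀) (hPr : 0 < halfSpaceRadialImpulse u₀)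
    {u : ℝ → EuclideanSpace ℝ (Fin 3) → EuclideanSpace ℝ (Fin 3)}
    {p : ℝ → EuclideanSpace ℝ (Fin 3) → ℝ} (hsol : ∀ T : ℝ, IsClassicalAxisymNoSwirlEuler T u₀ u p)
    (B : ℝ) : ∃ t : ℝ, 0 ≤ t ∧ B < halfSpaceRadialImpulse (u t) := by
  obtain ⟨-, hfloor⟩ := h u₀ he hs hax ha hn hap hPz hPr
  obtain ⟨C, hC, hmain⟩ := hfloor (1 / 15) (by norm_num)
  -- choose `t = ((|B| + 1)/C)^15`, so that `C (1 + t)^{1/15} ≥ C t^{1/15} = |B| + 1 > B`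
  set s : ℝ := (|B| + 1) / C with hs_def
  have hs0 : 0 ≤ s := by positivity
  set t : ℝ := s ^ 15 with ht_def
  have ht0 : 0 ≤ t := by positivity
  refine ⟨t, ht0, ?_⟩
  have hexp : (2 : ℝ) / 15 - 1 / 15 = ((15 : ℕ) : ℝ)⁻¹ := by norm_num
  have h1 := (hmain (t + 1) u p (hsol (t + 1)) t ⟨ht0, lt_add_one t⟩).1
  rw [hexp] at h1
  have h2 : s ≤ (1 + t) ^ (((15 : ℕ) : ℝ)⁻¹) := by
    calc s = (s ^ 15) ^ (((15 : ℕ) : ℝ)⁻¹) := (Real.pow_rpow_inv_natCast hs0 (by norm_num)).symm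
      _ ≤ (1 + t) ^ (((15 : ℕ) : ℝ)⁻¹) :=
          Real.rpow_le_rpow ht0 (by linarith) (by positivity)
  have h3 : C * s ≤ C * (1 + t) ^ (((15 : ℕ) : ℝ)⁻¹) := mul_le_mul_of_nonneg_left h2 hC.le
  have h4 : C * s = |B| + 1 := by rw [hs_def]; field_simp
  have h5 : B < |B| + 1 := by linarith [le_abs_self B]
  linarith

end Literature.Analysis.FluidPDE

end
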